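import Summits.QuantumFields.BalabanUV.Beta.FP.CoarseCovarianceStrip

/-!
# `BalabanUV.Beta.FP.CoarseCovarianceStripBound` — road «FP» (binder row D1), row H′2-IR ∕ IR-2 (ii), file (ii) part 2: **THE n-UNIFORM BOUND
# OF THE ALIAS CORRECTION `E_n` ON THE FAT REGION** — `‖En n k α β‖ ≤ ME d` for every `k ∈ Fat D rA` and every `n ≥ 1`
# (`‖feynC(k/n)‖ ≤ MF2/n²`, `‖Dwi₀‖, ‖Dwmi₀‖ ≤ (c0·n)^{−(D+1)}`, `‖Ftil‖ ≤ CA·n^{2D+4}`: the powers of `n` cancel exactly)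

HONEST FRAMING (cell contract, verbatim): «discharging `BetaPertH` makes Bałaban's UV stability UNCONDITIONAL — a real constructive-QFT
result; it is NOT the continuum limit and NOT the Clay problem.»  HONEST DEPENDENCY (verbatim): «continuum YM on T⁴ ⇐ BetaPertH ∧ nine
spine estimates (0/9 proved); BetaPertH ⇐ (D1) ∧ (D4) ∧ CAP+tail; G-an2-4 gates asym, D1 and NE2/3/4.»  THIS MODULE DISCHARGES NOTHING of
D1 ∕ BetaPertH: [folklore] entry bookkeeping over part 1 and files (F2)(Alias) BY NAME (`norm_exC_le`, `norm_cweight_aliasZero_ge`,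
`sum_alias_norm_le`, gan24's `norm_cexp_I_mul_sub_one_le'`).  Three [our object] CONSTANT defs (`c0`, `MF2`, `ME`, `d`-only); no `def … : Prop`;
nothing is cited; 0 sorry.  NOT summit progress; NOT BetaPertH, NOT continuum, NOT Clay.

ABSOLUTE RULE (cell, verbatim): «No internally-minted statement may enter as a cited fact. Every hypothesis is either kernel-proved in this
package or a verbatim quotation of a PUBLISHED theorem with page reference. The manuscript(s) under audit are NOT citable for their own
disputed steps — they are the thing under adjudication; programme-internal (2001/route/tribunal) claims are never citable.»

CONTENT (`D = d+1`): `En_apply`, `GC_apply` (entry formulas), `c0`∕`norm_cw0_inv_le`∕`norm_cwm0_inv_le`, `MF2`∕`norm_d1C_zero_alias_le`∕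
**`norm_feynC_zero_alias_le`** (`‖feynC (k/n) α β‖ ≤ MF2/n²` on `Fat D rA`), `norm_Ftil_le`, `ME`∕**`norm_En_le`**.
Unit `b2b-balaban-beta-d1-formalise-leaf-06` (gen 8), owner ruling R-FP-21 (A3)∕(C).
-/

noncomputable section

namespace Summit.QuantumFields.BalabanUV.Beta.FP.CoarseCovarianceStripBound

open Finset Complex Set Metric Matrix
open scoped BigOperators ComplexConjugate
open Literature.MathematicalPhysics.QuantumFieldTheory.Balaban1983to89
open B4Strip (Strip ofRealVec reVec S1 Delta1 U)
open B4StripCauchy (Fat)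
open B5Symbol166Strip (kappa166 kappa166_pos)
open Summit.QuantumFields.BalabanUV.Beta.GAN24.FibreSymbols (gsum)
open Summit.QuantumFields.BalabanUV.Beta.GAN24.AliasDecimate (aliasPt)
open Summit.QuantumFields.BalabanUV.Beta.GAN24.PushSumSymbol (cweight)
open Summit.QuantumFields.BalabanUV.Beta.FP.PerfectSymbol166StripReg (bound166 bound166_nonneg)
open Summit.QuantumFields.BalabanUV.Beta.FP.PerfectPropagatorSymbol (curlRow)
open Summit.QuantumFields.BalabanUV.Beta.FP.CoarseCovarianceAlias (covSymMean covSymMean_apply)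
open Summit.QuantumFields.BalabanUV.Beta.FP.CoarseCovarianceStripW
open Summit.QuantumFields.BalabanUV.Beta.FP.CoarseCovarianceStripFeyn
open Summit.QuantumFields.BalabanUV.Beta.FP.CoarseCovarianceStripFeynReg
open Summit.QuantumFields.BalabanUV.Beta.FP.CoarseCovarianceStripProp
open Summit.QuantumFields.BalabanUV.Beta.FP.CoarseCovarianceStripPropCone
open Summit.QuantumFields.BalabanUV.Beta.FP.CoarseCovarianceStripAlias
open Summit.QuantumFields.BalabanUV.Beta.FP.CoarseCovarianceStripAliasWeights (aliasPt_apply' aliasPt_im)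

open Summit.QuantumFields.BalabanUV.Beta.FP.CoarseCovarianceStrip

variable {d : ℕ}

/-! ## §4 Entry formulas and the n-uniform bound of `En` on the fat region -/

/-- [folklore] entries of `En`. -/
theorem En_apply (n : ℕ) [NeZero n] (k : Fin (d + 1) → ℂ) (α β : Fin (d + 1)) :
    En n k α β = (∑ κ, feynC (aliasPt n (fun _ => (0 : Fin n)) k) α κ * (cweight n κ (aliasPt n (fun _ => (0 : Fin n)) k))⁻¹ * Ftil n k κ β)
      * (cweight n β (-aliasPt n (fun _ => (0 : Fin n)) k))⁻¹ := by
  rw [En, Dwmi, mul_diagonal, Matrix.mul_apply]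
  congr 1
  exact Finset.sum_congr rfl fun κ _ => by rw [Dwi, mul_diagonal]

/-- [folklore] entries of `GC`. -/
theorem GC_apply (n : ℕ) [NeZero n] (k : Fin (d + 1) → ℂ) (α β : Fin (d + 1)) :
    GC n k α β = ((n : ℂ) ^ (3 * (d + 1) + 2)) * ((∑ κ, (cweight n α (-aliasPt n (fun _ => (0 : Fin n)) k))⁻¹ * (Bn n k)⁻¹ α κ *
      feynC (aliasPt n (fun _ => (0 : Fin n)) k) κ β) * (cweight n β (aliasPt n (fun _ => (0 : Fin n)) k))⁻¹) := by
  rw [GC, Matrix.smul_apply, smul_eq_mul, Dwi, mul_diagonal, Matrix.mul_apply]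
  congr 2
  exact Finset.sum_congr rfl fun κ _ => by rw [Dwmi, diagonal_mul]

/-- [our object] the lower weight constant `c0 := (3/16)·e^{−2 rA}` (`c0·n ≤ ‖gsum (k_i/n) n‖` on `Fat D rA`). -/
def c0 (d : ℕ) : ℝ := 3 / 16 * Real.exp (-(2 * rA d))

/-- [folklore] `0 < c0`. -/
theorem c0_pos (d : ℕ) : 0 < c0 d := by unfold c0; positivity

/-- [folklore] `‖(cweight n κ (k/n))⁻¹‖ ≤ ((c0·n)^{D+1})⁻¹` on `Fat D rA`. -/
theorem norm_cw0_inv_le (n : ℕ) [NeZero n] {k : Fin (d + 1) → ℂ} (hk : k ∈ Fat (d + 1) (rA d)) (κ : Fin (d + 1)) :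
    ‖(cweight n κ (aliasPt n (fun _ => (0 : Fin n)) k))⁻¹‖ ≤ ((c0 d * n) ^ (d + 2))⁻¹ := by
  rw [norm_inv]
  have hn : (0 : ℝ) < n := by exact_mod_cast Nat.pos_of_ne_zero (NeZero.ne n)
  exact inv_anti₀ (by have := c0_pos d; positivity) (norm_cweight_aliasZero_ge n (rA_le_quarter d) hk κ)

/-- [folklore] `‖(cweight n λ (−k/n))⁻¹‖ ≤ ((c0·n)^{D+1})⁻¹` on `Fat D rA`. -/
theorem norm_cwm0_inv_le (n : ℕ) [NeZero n] {k : Fin (d + 1) → ℂ} (hk : k ∈ Fat (d + 1) (rA d)) (lam : Fin (d + 1)) :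
    ‖(cweight n lam (-aliasPt n (fun _ => (0 : Fin n)) k))⁻¹‖ ≤ ((c0 d * n) ^ (d + 2))⁻¹ := by
  rw [norm_inv]
  have hn : (0 : ℝ) < n := by exact_mod_cast Nat.pos_of_ne_zero (NeZero.ne n)
  exact inv_anti₀ (by have := c0_pos d; positivity) (norm_cweight_neg_aliasZero_ge n (rA_le_quarter d) hk lam)

/-- [our object] the small-momentum Feynman constant `MF2 := (D + 2D²(M₁₆₆ + 1))·((π + 3 rA)·e^{2 rA})²`. -/
def MF2 (d : ℕ) : ℝ := (((d : ℝ) + 1) + 2 * ((d : ℝ) + 1) ^ 2 * (bound166 (d + 1) + 1)) * ((Real.pi + 3 * rA d) * Real.exp (2 * rA d)) ^ 2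

/-- [folklore] `0 < MF2`. -/
theorem MF2_pos (d : ℕ) : 0 < MF2 d := by
  unfold MF2; have := bound166_nonneg (d + 1); have := rA_pos d; positivity

/-- [folklore] the momentum factors at `k/n`, `k ∈ Fat D rA`: `‖p̂_a(±k/n)‖ ≤ (π + 3rA)·e^{2rA}/n`. -/
theorem norm_d1C_zero_alias_le (n : ℕ) [NeZero n] {k : Fin (d + 1) → ℂ} (hk : k ∈ Fat (d + 1) (rA d)) (a : Fin (d + 1)) :
    ‖d1C (aliasPt n (fun _ => (0 : Fin n)) k) a‖ ≤ (Real.pi + 3 * rA d) * Real.exp (2 * rA d) / n ∧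
    ‖d1C (-aliasPt n (fun _ => (0 : Fin n)) k) a‖ ≤ (Real.pi + 3 * rA d) * Real.exp (2 * rA d) / n := by
  have hn : (0 : ℝ) < n := by exact_mod_cast Nat.pos_of_ne_zero (NeZero.ne n)
  have hn1 : (1 : ℝ) ≤ n := by exact_mod_cast Nat.one_le_iff_ne_zero.mpr (NeZero.ne n)
  have hre : |(k a).re| ≤ Real.pi + rA d := (hk a).1
  have him : |(k a).im| ≤ 2 * rA d := (hk a).2
  have hrA := rA_pos d
  have key : ∀ w : ℂ, w.re = (k a).re / n ∨ w.re = -((k a).re / n) → |w.im| = |(k a).im| / n →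
      ‖Complex.exp (w * I) - 1‖ ≤ (Real.pi + 3 * rA d) * Real.exp (2 * rA d) / n := by
    intro w hwre hwim
    have h1 := GAN24.AliasStripSymbols.norm_cexp_I_mul_sub_one_le' w
    rw [mul_comm] at h1
    have hwre' : |w.re| = |(k a).re| / n := by
      rcases hwre with h | h <;> rw [h] <;> simp [abs_div, abs_neg, abs_of_pos hn]
    rw [hwre', hwim] at h1
    have him' : |(k a).im| / n ≤ 2 * rA d := (div_le_self (abs_nonneg _) hn1).trans him
    have hexp : Real.exp (|(k a).im| / n) ≤ Real.exp (2 * rA d) := Real.exp_le_exp.mpr him'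
    calc ‖Complex.exp (w * I) - 1‖ ≤ (|(k a).re| / n + |(k a).im| / n) * Real.exp (|(k a).im| / n) := h1
      _ ≤ ((Real.pi + 3 * rA d) / n) * Real.exp (2 * rA d) := by
          apply mul_le_mul _ hexp (by positivity) (by positivity)
          rw [← add_div]; exact div_le_div_of_nonneg_right (by linarith) hn.le
      _ = (Real.pi + 3 * rA d) * Real.exp (2 * rA d) / n := by ring
  constructor
  · rw [d1C_apply]
    exact key _ (Or.inl (by rw [aliasPt_re]; simp)) (by rw [aliasPt_im, abs_div, abs_of_pos hn])
  · rw [d1C_apply]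
    refine key _ (Or.inr ?_) ?_
    · rw [Pi.neg_apply, Complex.neg_re, aliasPt_re]; simp
    · rw [Pi.neg_apply, Complex.neg_im, abs_neg, aliasPt_im, abs_div, abs_of_pos hn]

/-- [our object] **THE FEYNMAN MATRIX IS SMALL AT THE `l = 0` ALIAS POINT**: `‖feynC (k/n) α β‖ ≤ MF2/n²` for `k ∈ Fat D rA`. -/
theorem norm_feynC_zero_alias_le (n : ℕ) [NeZero n] {k : Fin (d + 1) → ℂ} (hk : k ∈ Fat (d + 1) (rA d)) (α β : Fin (d + 1)) :
    ‖feynC (aliasPt n (fun _ => (0 : Fin n)) k) α β‖ ≤ MF2 d / (n : ℝ) ^ 2 := by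
  have hn : (0 : ℝ) < n := by exact_mod_cast Nat.pos_of_ne_zero (NeZero.ne n)
  set p := aliasPt n (fun _ => (0 : Fin n)) k with hp
  set aD := (Real.pi + 3 * rA d) * Real.exp (2 * rA d) / n with haD
  have haD0 : 0 ≤ aD := by have := rA_pos d; positivity
  have ha : ∀ μ, ‖d1C (-p) μ‖ ≤ aD := fun μ => (norm_d1C_zero_alias_le n hk μ).2
  have hb : ∀ μ, ‖d1C p μ‖ ≤ aD := fun μ => (norm_d1C_zero_alias_le n hk μ).1
  have hP : p ∈ PStrip (d + 1) (kappa166 (d + 1)) := fun i => by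
    rw [hp, aliasPt_im, abs_div, Nat.abs_cast]
    have h1 : |(k i).im| / n ≤ |(k i).im| := div_le_self (abs_nonneg _) (by exact_mod_cast Nat.one_le_iff_ne_zero.mpr (NeZero.ne n))
    have h2 : |(k i).im| ≤ 2 * rA d := (hk i).2
    linarith [two_rA_le_kap0 d, kap0_le_rF d, two_rF_lt d, rF_pos d]
  have hv : ∀ μ ν, μ ≠ ν → ‖Wper μ ν p - 1‖ ≤ bound166 (d + 1) + 1 := fun μ ν _ =>
    (norm_sub_le _ _).trans (add_le_add (norm_Wper_le μ ν hP) (by simp))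
  have hex := norm_exC_le (by have := bound166_nonneg (d + 1); positivity) haD0 haD0 hv ha hb α β
  have hΔ : ‖Delta1 0 p‖ ≤ ((d : ℝ) + 1) * aD * aD := by
    rw [← sum_d1C_neg_mul]
    calc ‖∑ a, d1C (-p) a * d1C p a‖ ≤ ∑ a, ‖d1C (-p) a * d1C p a‖ := norm_sum_le _ _
      _ ≤ ∑ _a : Fin (d + 1), aD * aD := Finset.sum_le_sum fun a _ => by
          rw [norm_mul]; exact mul_le_mul (ha a) (hb a) (norm_nonneg _) haD0
      _ = ((d : ℝ) + 1) * aD * aD := by simp; ring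
  rw [feynC_eq_Delta1_add_exC]
  calc ‖(if α = β then Delta1 0 p else 0) + exC (fun μ ν => Wper μ ν p - 1) p α β‖
      ≤ ‖(if α = β then Delta1 0 p else 0)‖ + ‖exC (fun μ ν => Wper μ ν p - 1) p α β‖ := norm_add_le _ _
    _ ≤ ((d : ℝ) + 1) * aD * aD + 2 * ((d : ℝ) + 1) ^ 2 * (bound166 (d + 1) + 1) * aD * aD := by
        refine add_le_add ?_ hex
        split_ifs
        · exact hΔ
        · rw [norm_zero]; positivity
    _ = MF2 d / (n : ℝ) ^ 2 := by rw [haD, MF2]; field_simp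

/-- [our object] **`Ftil` entries `≤ CA·n^{2D+4}`** on `Fat D rA` (file (Alias) part 2 `sum_alias_norm_le`). -/
theorem norm_Ftil_le (n : ℕ) [NeZero n] {k : Fin (d + 1) → ℂ} (hk : k ∈ Fat (d + 1) (rA d)) (κ lam : Fin (d + 1)) :
    ‖Ftil n k κ lam‖ ≤ CA d * (n : ℝ) ^ (2 * (d + 1) + 4) := by
  rw [Ftil_apply]
  exact (norm_sum_le _ _).trans (sum_alias_norm_le n hk κ lam)

/-- [our object] the `En` constant `ME := D·MF2·CA/c0^{2D+2}`. -/
def ME (d : ℕ) : ℝ := ((d : ℝ) + 1) * MF2 d * CA d / c0 d ^ (2 * (d + 2))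

/-- [folklore] `0 < ME`. -/
theorem ME_pos (d : ℕ) : 0 < ME d := by
  unfold ME; have := MF2_pos d; have := CA_pos d; have := c0_pos d; positivity

/-- [our object] **THE n-UNIFORM BOUND OF `En` ON THE FAT REGION**: `‖En n k α β‖ ≤ ME d` for `k ∈ Fat D rA`, every `n ≥ 1`
(the powers `n^{−2}·n^{−(D+1)}·n^{2D+4}·n^{−(D+1)}` cancel). -/
theorem norm_En_le (n : ℕ) [NeZero n] {k : Fin (d + 1) → ℂ} (hk : k ∈ Fat (d + 1) (rA d)) (α β : Fin (d + 1)) :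
    ‖En n k α β‖ ≤ ME d := by
  have hn : (0 : ℝ) < n := by exact_mod_cast Nat.pos_of_ne_zero (NeZero.ne n)
  have hc := c0_pos d
  have hM := MF2_pos d
  have hA := CA_pos d
  set W : ℝ := ((c0 d * n) ^ (d + 2))⁻¹ with hW
  have hW0 : 0 ≤ W := by positivity
  rw [En_apply, norm_mul]
  have hsum : ‖∑ κ, feynC (aliasPt n (fun _ => (0 : Fin n)) k) α κ * (cweight n κ (aliasPt n (fun _ => (0 : Fin n)) k))⁻¹ * Ftil n k κ β‖
      ≤ ((d : ℝ) + 1) * (MF2 d / (n : ℝ) ^ 2 * W * (CA d * (n : ℝ) ^ (2 * (d + 1) + 4))) := by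
    calc _ ≤ ∑ κ, ‖feynC (aliasPt n (fun _ => (0 : Fin n)) k) α κ * (cweight n κ (aliasPt n (fun _ => (0 : Fin n)) k))⁻¹ * Ftil n k κ β‖ :=
          norm_sum_le _ _
      _ ≤ ∑ _κ : Fin (d + 1), MF2 d / (n : ℝ) ^ 2 * W * (CA d * (n : ℝ) ^ (2 * (d + 1) + 4)) :=
          Finset.sum_le_sum fun κ _ => by
            rw [norm_mul, norm_mul]
            exact mul_le_mul (mul_le_mul (norm_feynC_zero_alias_le n hk α κ) (norm_cw0_inv_le n hk κ) (norm_nonneg _) (by positivity))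
              (norm_Ftil_le n hk κ β) (norm_nonneg _) (by positivity)
      _ = ((d : ℝ) + 1) * (MF2 d / (n : ℝ) ^ 2 * W * (CA d * (n : ℝ) ^ (2 * (d + 1) + 4))) := by
          simp only [Finset.sum_const, Finset.card_univ, Fintype.card_fin, nsmul_eq_mul]; push_cast; ring
  calc _ ≤ ((d : ℝ) + 1) * (MF2 d / (n : ℝ) ^ 2 * W * (CA d * (n : ℝ) ^ (2 * (d + 1) + 4))) * W :=
        mul_le_mul hsum (norm_cwm0_inv_le n hk β) (norm_nonneg _) (by positivity)
    _ = ME d := by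
        rw [hW, ME]
        field_simp
        ring

end Summit.QuantumFields.BalabanUV.Beta.FP.CoarseCovarianceStripBound

end
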